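import Literature.AlgebraicGeometry.Resolution.ReducedCurveGermNormalization
import Mathlib.RingTheory.Polynomial.ScaleRoots
import Mathlib.RingTheory.Localization.Integral
import Mathlib.RingTheory.Localization.Submodule
import Mathlib.RingTheory.Localization.AtPrime.Basic
import HarnessLib

/-!
# The normalization of a quadratic transform of a reduced one-dimensional local ring

Topic: `Literature/AlgebraicGeometry/Resolution`. Ring-theoretic core of the blow-up step in
Kollár 2007, Thm. 1.101 (3) ⇒ (1) [Kru30, Satz 7], for REDUCED (not necessarily integral)
one-dimensional local rings. Data: `(R, 𝔪)` reduced Noetherian local of dimension one, `K` its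
total ring of fractions, `R̄ = integralClosure R K` module-finite; a non-zero-divisor `c ∈ 𝔪`; a
subalgebra `B ⊆ K` with `𝔪/c ⊆ B ⊆ ⋃ₙ 𝔪ⁿ/cⁿ` (the chart `R[𝔪/c]` of the blow-up of `𝔪`,
Stacks 0804); a prime `𝔴 ⊆ B` over `𝔪`; its local ring `R' = B_𝔴` (a local quadratic transform
of `R`) and `Q' = K_𝔴`, the localization of `K` at the image of `B ∖ 𝔴`. PROVED here:

* `exists_pow_mul_mem_of_isIntegral` — if `N ⊆ K` is integrally closed in `K`, `u ∈ N`, and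
  `B ⊆ N[u⁻¹]` (every `b ∈ B` has `uᵏ b ∈ N`), then every `y ∈ K` integral over `B` has
  `uᵏ y ∈ N` (scale the roots of a monic equation by `uᵏ`);
* `QuadraticTransform.algebraMap_injective`, `…isLocalization_map_nonZeroDivisors`,
  `…isFractionRing`, `…isReduced` — `R' → Q'` is injective, `Q'` is the localization of `R'` at
  the image of `R⁰`, **`Q'` is the total ring of fractions of `R'`** (non-zero-divisors of `Q'`
  are units, `K` being Artinian), and `R'` is reduced;
* `QuadraticTransform.integralClosure_le_adjoin` (with `adjoin_le_integralClosure`) — **the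
  integral closure of `R'` in `Q'` is generated by the image of `R̄`**: `𝔪R̄ = gR̄` is principal
  (`isPrincipalIdealRing_integralClosure`), `c = g u'`, `B ⊆ R̄[u'⁻¹]` with `R̄[u'⁻¹]` integrally
  closed in `K`, `u'` is a unit of `R'[R̄]` (its inverse `g/c` lies in `R'·R̄`), and integrality
  descends along the localizations `R' = B_𝔴`, `Q' = K_𝔴` (Mathlib's
  `IsIntegral.exists_multiple_integral_of_isLocalization`,
  `IsLocalization.exists_isIntegral_smul_of_isIntegral_map`).

No definitions, no named facts. Sources: J. Kollár, *Lectures on Resolution of Singularities*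
(2007), §1.13, Thm. 1.101, Lemma 1.99 [Kollar2007]; The Stacks Project, Tag 0804 [StacksProject].
-/

noncomputable section

open IsLocalRing Polynomial nonZeroDivisors

namespace Literature.AlgebraicGeometry.Resolution

universe u

/-! ## Integral elements over a subalgebra of `N[u⁻¹]` -/

section PowMul

variable {A : Type u} [CommRing A] {K : Type u} [CommRing K] [Algebra A K]

/-- Let `N ⊆ K` be a subalgebra integrally closed in `K`, `u ∈ N`, and `B ⊆ K` a subalgebra all of
whose elements `b` satisfy `uᵏ b ∈ N` for some `k`. Then every `y ∈ K` integral over `B`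
satisfies `uᵏ y ∈ N` for some `k`: if `p(y) = 0` with `p` monic over `B`, then `uᵏ y` is a root of
the monic polynomial `p` with roots scaled by `uᵏ`, whose coefficients lie in `N` for `k` large
(the localization step in the proof of Kollár's Thm. 1.101). [cite: Kollar2007, Thm. 1.101] -/
theorem exists_pow_mul_mem_of_isIntegral (N B : Subalgebra A K)
    (hN : ∀ y : K, IsIntegral N y → y ∈ N) {u : K} (hu : u ∈ N)
    (hB : ∀ b ∈ B, ∃ k : ℕ, u ^ k * b ∈ N) {y : K} (hy : IsIntegral B y) :
    ∃ k : ℕ, u ^ k * y ∈ N := by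
  classical
  nontriviality K
  obtain ⟨p, hp, hpy⟩ := hy
  -- a common exponent for the coefficients
  choose kf hkf using fun i : ℕ => hB (p.coeff i : K) (p.coeff i).2
  set k : ℕ := (Finset.range (p.natDegree + 1)).sup kf with hk
  have hcoef : ∀ i ≤ p.natDegree, u ^ k * (p.coeff i : K) ∈ N := by
    intro i hi
    have hle : kf i ≤ k := Finset.le_sup (f := kf) (Finset.mem_range.mpr (Nat.lt_succ_of_le hi))
    have : u ^ k * (p.coeff i : K) = u ^ (k - kf i) * (u ^ kf i * (p.coeff i : K)) := by
      rw [← mul_assoc, ← pow_add, Nat.sub_add_cancel hle]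
    rw [this]
    exact N.mul_mem (N.pow_mem hu _) (hkf i)
  -- the scaled polynomial
  set P : K[X] := (p.map (algebraMap B K)).scaleRoots (u ^ k) with hP
  have hPmonic : P.Monic := by rw [hP, monic_scaleRoots_iff]; exact hp.map _
  have hdeg : (p.map (algebraMap B K)).natDegree = p.natDegree := hp.natDegree_map _
  have hPcoeff : ∀ i, P.coeff i ∈ N := by
    intro i
    rw [hP, coeff_scaleRoots, coeff_map, hdeg]
    by_cases hi : i < p.natDegree
    · obtain ⟨e, he⟩ : ∃ e, p.natDegree - i = e + 1 := ⟨p.natDegree - i - 1, by omega⟩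
      rw [he, pow_succ, ← mul_assoc, mul_comm _ (u ^ k), ← pow_mul, ← mul_assoc]
      exact N.mul_mem (hcoef i hi.le) (N.pow_mem hu _)
    · by_cases hi' : i = p.natDegree
      · subst hi'
        rw [hp.coeff_natDegree, map_one, one_mul, Nat.sub_self, pow_zero]
        exact N.one_mem
      · have hlt : p.natDegree < i := lt_of_le_of_ne (not_lt.mp hi) (Ne.symm hi')
        rw [coeff_eq_zero_of_natDegree_lt hlt, map_zero, zero_mul]
        exact N.zero_mem
  have hPlifts : P ∈ Polynomial.lifts (algebraMap N K) := by
    rw [Polynomial.lifts_iff_coeff_lifts]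
    intro i
    exact ⟨⟨P.coeff i, hPcoeff i⟩, rfl⟩
  obtain ⟨Q, hQP, -, hQmonic⟩ := Polynomial.lifts_and_natDegree_eq_and_monic hPlifts hPmonic
  refine ⟨k, hN _ ⟨Q, hQmonic, ?_⟩⟩
  have hy' : eval y (p.map (algebraMap B K)) = 0 := by rw [eval_map]; exact hpy
  rw [← eval_map, hQP, hP, scaleRoots_eval_mul, hy', mul_zero]

end PowMul

/-! ## The quadratic transform `R' = B_𝔴` and its ring of fractions `Q' = K_𝔴` -/

namespace QuadraticTransform

/-- Non-zero-divisors of `R` are units in any algebra `L` over the total ring of fractions `K`.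
[cite: StacksProject, Tag 02LX] -/
theorem isUnit_algebraMap_of_mem_nonZeroDivisors (R : Type u) [CommRing R] (K : Type u)
    [CommRing K] [Algebra R K] [IsFractionRing R K] (L : Type u) [CommRing L] [Algebra K L]
    [Algebra R L] [IsScalarTower R K L] (r : R) (hr : r ∈ R⁰) :
    IsUnit (algebraMap R L r) := by
  rw [IsScalarTower.algebraMap_apply R K L]
  exact (IsLocalization.map_units K ⟨r, hr⟩).map _

/-- Elements of `B ∖ 𝔴` become units in `Q' = K_𝔴`. [cite: StacksProject, Tag 0804] -/
theorem isUnit_algebraMap_of_mem_primeCompl {R : Type u} [CommRing R] {K : Type u} [CommRing K]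
    [Algebra R K] {B : Subalgebra R K} (𝔴 : Ideal B) [𝔴.IsPrime] (Q' : Type u) [CommRing Q']
    [Algebra K Q'] [IsLocalization (𝔴.primeCompl.map (algebraMap B K)) Q'] (s : B)
    (hs : s ∈ 𝔴.primeCompl) :
    IsUnit (algebraMap K Q' (s : K)) :=
  IsLocalization.map_units Q' ⟨(s : K), Submonoid.mem_map_of_mem (algebraMap B K) hs⟩

variable {R : Type u} [CommRing R] [IsLocalRing R] [IsNoetherianRing R] [IsReduced R]
  {K : Type u} [CommRing K] [Algebra R K] [IsFractionRing R K]
  {B : Subalgebra R K} (𝔴 : Ideal B) [𝔴.IsPrime]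
  (R' : Type u) [CommRing R'] [Algebra B R'] [IsLocalization.AtPrime R' 𝔴]
  [Algebra R R']
  (Q' : Type u) [CommRing Q'] [Algebra K Q']
  [IsLocalization (𝔴.primeCompl.map (algebraMap B K)) Q']
  [Algebra R' Q'] [Algebra R Q'] [IsScalarTower B R' Q'] [IsScalarTower R K Q']
  [IsScalarTower R R' Q']

include 𝔴 R' Q'

section Fractions

omit [IsLocalRing R] [IsNoetherianRing R] [IsReduced R] [IsFractionRing R K]
  [Algebra R R'] [Algebra R Q'] [IsScalarTower R K Q']
  [IsScalarTower R R' Q'] in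
/-- `R' = B_𝔴 → Q' = K_𝔴` is injective: if `b₁/1 = b₂/1` in `K_𝔴` then `s b₁ = s b₂` in `K`,
hence in `B`, for some `s ∉ 𝔴`. [cite: StacksProject, Tag 0804] -/
theorem algebraMap_injective : Function.Injective (algebraMap R' Q') := by
  rw [IsLocalization.injective_iff_map_algebraMap_eq 𝔴.primeCompl]
  intro x y
  constructor
  · intro h; rw [h]
  · intro h
    rw [← IsScalarTower.algebraMap_apply, ← IsScalarTower.algebraMap_apply,
      IsScalarTower.algebraMap_apply B K Q', IsScalarTower.algebraMap_apply B K Q'] at h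
    obtain ⟨⟨_, s, hs, rfl⟩, hs'⟩ :=
      (IsLocalization.eq_iff_exists (𝔴.primeCompl.map (algebraMap B K)) Q').mp h
    have hB : (s : B) * x = s * y := by
      apply Subtype.ext
      exact hs'
    exact (IsLocalization.eq_iff_exists 𝔴.primeCompl R').mpr ⟨⟨s, hs⟩, hB⟩

omit [IsLocalRing R] [IsNoetherianRing R] [IsReduced R] in
/-- `Q' = K_𝔴` is the localization of `R' = B_𝔴` at the image of `R⁰`.
[cite: StacksProject, Tag 0804] -/
theorem isLocalization_map_nonZeroDivisors :
    IsLocalization ((R⁰).map (algebraMap R R')) Q' := by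
  refine (isLocalization_iff _ _).mpr ⟨?_, ?_, ?_⟩
  · rintro ⟨_, r, hr, rfl⟩
    rw [← IsScalarTower.algebraMap_apply]
    exact isUnit_algebraMap_of_mem_nonZeroDivisors R K Q' r hr
  · intro q
    obtain ⟨⟨y, ⟨_, s, hs, rfl⟩⟩, hq⟩ :=
      IsLocalization.surj (𝔴.primeCompl.map (algebraMap B K)) q
    obtain ⟨⟨a, t⟩, hy⟩ := IsLocalization.surj R⁰ y
    -- `q · s = y`, `y · t = a`; `s` is a unit of `R'`
    have hsu : IsUnit (algebraMap B R' s) := IsLocalization.map_units R' ⟨s, hs⟩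
    obtain ⟨v, hv⟩ := hsu.exists_left_inv
    refine ⟨⟨v * algebraMap R R' a, ⟨algebraMap R R' t, Submonoid.mem_map_of_mem _ t.2⟩⟩, ?_⟩
    change q * algebraMap R' Q' (algebraMap R R' t) = algebraMap R' Q' (v * algebraMap R R' a)
    have e1 : algebraMap R' Q' (algebraMap R R' (t : R)) = algebraMap K Q' (algebraMap R K t) := by
      rw [← IsScalarTower.algebraMap_apply, IsScalarTower.algebraMap_apply R K Q']
    have e2 : algebraMap R' Q' (algebraMap R R' a) = algebraMap K Q' (algebraMap R K a) := by
      rw [← IsScalarTower.algebraMap_apply, IsScalarTower.algebraMap_apply R K Q']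
    have e3 : algebraMap R' Q' (algebraMap B R' s) = algebraMap K Q' (s : K) := by
      rw [← IsScalarTower.algebraMap_apply B R' Q' s]; rfl
    have hq' : q * algebraMap K Q' (s : K) = algebraMap K Q' y := hq
    have hvs : algebraMap R' Q' v * algebraMap K Q' (s : K) = 1 := by
      rw [← e3, ← map_mul, hv, map_one]
    rw [map_mul, e2, ← hy, map_mul, ← hq', e1]
    calc q * algebraMap K Q' (algebraMap R K ↑t)
        = q * algebraMap K Q' (algebraMap R K ↑t) * (algebraMap R' Q' v * algebraMap K Q' ↑s) := by
          rw [hvs, mul_one]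
      _ = algebraMap R' Q' v * (q * algebraMap K Q' ↑s * algebraMap K Q' (algebraMap R K ↑t)) := by
          ring
  · intro x y h
    exact ⟨1, by rw [algebraMap_injective 𝔴 R' Q' h]⟩

omit [IsLocalRing R] in
/-- **`Q' = K_𝔴` is the total ring of fractions of the quadratic transform `R' = B_𝔴`**: it is the
localization of `R'` at (the image of) `R⁰ ⊆ R'⁰`, and every non-zero-divisor of `Q'` is a unit
(`Q'` is a localization of the Artinian ring `K`). [cite: Kollar2007, Thm. 1.101] -/
theorem isFractionRing : IsFractionRing R' Q' := by
  haveI := isLocalization_map_nonZeroDivisors 𝔴 R' Q'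
  refine isFractionRing_of_isLocalization_of_forall_isUnit ((R⁰).map (algebraMap R R')) Q' ?_ ?_
  · rintro _ ⟨r, hr, rfl⟩
    -- a unit of `Q'` pulled back along the injection `R' → Q'` is a non-zero-divisor
    rw [mem_nonZeroDivisors_iff_right]
    intro x hx
    apply algebraMap_injective 𝔴 R' Q'
    rw [map_zero]
    have h1 : algebraMap R' Q' x * algebraMap R' Q' (algebraMap R R' r) = 0 := by
      rw [← map_mul, hx, map_zero]
    rw [← IsScalarTower.algebraMap_apply] at h1
    exact (isUnit_algebraMap_of_mem_nonZeroDivisors R K Q' r hr).mul_left_eq_zero.mp h1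
  · intro z hz
    exact isUnit_of_mem_nonZeroDivisors_of_isLocalization_fractionRing R K
      (𝔴.primeCompl.map (algebraMap B K)) Q' hz

omit [IsLocalRing R] [IsNoetherianRing R] [Algebra R R'] [Algebra R Q']
  [IsScalarTower R K Q'] [IsScalarTower R R' Q'] in
/-- `R'` is reduced (it embeds into a localization of the reduced ring `K`). [cite: StacksProject, Tag 02LX] -/
theorem isReduced : IsReduced R' := by
  haveI : IsReduced K := isReduced_of_isFractionRing R K
  haveI : IsReduced (Localization (𝔴.primeCompl.map (algebraMap B K))) := inferInstance
  haveI : IsReduced Q' := isReduced_of_injective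
    (IsLocalization.algEquiv (𝔴.primeCompl.map (algebraMap B K)) Q'
      (Localization (𝔴.primeCompl.map (algebraMap B K)))).toRingHom
    (IsLocalization.algEquiv (𝔴.primeCompl.map (algebraMap B K)) Q' _).injective
  exact isReduced_of_injective (algebraMap R' Q') (algebraMap_injective 𝔴 R' Q')

end Fractions


/-! ## The integral closure of `R'` in `Q'` is generated by the normalization of `R` -/

section Key

omit 𝔴 [IsReduced R] [IsFractionRing R K] [𝔴.IsPrime] [IsLocalization.AtPrime R' 𝔴]
  [IsLocalization (𝔴.primeCompl.map (algebraMap B K)) Q'] [IsLocalRing R]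
  [IsNoetherianRing R] [Algebra B R'] [IsScalarTower B R' Q'] in
/-- The image of `R̄` in `Q'` consists of elements integral over `R'`. [cite: Kollar2007, Thm. 1.101] -/
theorem adjoin_le_integralClosure :
    Algebra.adjoin R' (algebraMap K Q' '' (integralClosure R K : Set K)) ≤
      integralClosure R' Q' := by
  refine Algebra.adjoin_le ?_
  rintro _ ⟨n, hn, rfl⟩
  have h1 : IsIntegral R (algebraMap K Q' n) := IsIntegral.map (IsScalarTower.toAlgHom R K Q') hn
  exact h1.tower_top

omit [Algebra R R'] [Algebra R Q'] [IsScalarTower R K Q'] [IsScalarTower R R' Q'] in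
/-- **The integral closure of the quadratic transform `R' = B_𝔴` in its total ring of fractions
`Q' = K_𝔴` is generated by the image of `R̄`.** With `𝔪R̄ = gR̄` (`R̄` is a principal ideal
ring), `c = u' g`: every `b ∈ B ⊆ ⋃ 𝔪ⁿ/cⁿ` has `u'ᵏ b ∈ R̄`, so every element of `K` integral
over `B` has the same property (`exists_pow_mul_mem_of_isIntegral`); `u'` is a unit of
`R'[R̄] ⊆ Q'` (its inverse is `g/c ∈ R'·R̄`, as `𝔪/c ⊆ B`); and integrality over `R' = B_𝔴` in
`Q' = K_𝔴` descends to integrality over `B` in `K` after multiplying by units from `B ∖ 𝔴`.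
[cite: Kollar2007, Thm. 1.101] -/
theorem integralClosure_le_adjoin (hdim : ringKrullDim R = 1)
    [Module.Finite R (integralClosure R K)] {c : R} (hc : c ∈ maximalIdeal R) (hc0 : c ∈ R⁰)
    (hB1 : ∀ m ∈ maximalIdeal R, ∃ b ∈ B, algebraMap R K m = algebraMap R K c * b)
    (hB2 : ∀ b ∈ B, ∃ n : ℕ, ∃ m ∈ maximalIdeal R ^ n,
      algebraMap R K (c ^ n) * b = algebraMap R K m) :
    integralClosure R' Q' ≤
      Algebra.adjoin R' (algebraMap K Q' '' (integralClosure R K : Set K)) := by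
  classical
  set N := integralClosure R K with hN
  set lam := algebraMap K Q' with hlam
  set V : Subalgebra R' Q' := Algebra.adjoin R' (lam '' (N : Set K)) with hV
  -- bookkeeping: images of `B`, `R` and `N` lie in `V`
  have hlamB : ∀ b : B, lam (b : K) = algebraMap R' Q' (algebraMap B R' b) := fun b => by
    rw [← IsScalarTower.algebraMap_apply B R' Q' b]; rfl
  have hBV : ∀ b : B, lam (b : K) ∈ V := fun b => by
    rw [hlamB]; exact V.algebraMap_mem _
  have hNV : ∀ n ∈ N, lam n ∈ V := fun n hn => Algebra.subset_adjoin ⟨n, hn, rfl⟩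
  -- `N` is integrally closed in `K`
  have hNic : ∀ y : K, IsIntegral N y → y ∈ N := fun y hy => isIntegral_trans y hy
  -- `c` and the generator `g` of `𝔪 R̄`
  have hcK : IsUnit (algebraMap R K c) := IsLocalization.map_units K ⟨c, hc0⟩
  have hcQ : IsUnit (lam (algebraMap R K c)) := hcK.map _
  haveI hPIR := isPrincipalIdealRing_integralClosure R K hdim
  set J : Ideal N := (maximalIdeal R).map (algebraMap R N) with hJ
  obtain ⟨g, hg⟩ := (hPIR.principal J).principal
  have hgJ : g ∈ J := by rw [hg]; exact Ideal.mem_span_singleton_self g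
  have hmemJ : ∀ m ∈ maximalIdeal R, algebraMap R N m ∈ J := fun m hm =>
    Ideal.mem_map_of_mem _ hm
  obtain ⟨u', hu'⟩ := Ideal.mem_span_singleton'.mp (hg ▸ hmemJ c hc : algebraMap R N c ∈ _)
  -- `c = u' g` in `K`
  have hcug : algebraMap R K c = (u' : K) * (g : K) := by
    have := congrArg (fun x : N => (x : K)) hu'
    simpa using this.symm
  have hgK : IsUnit (g : K) := isUnit_of_mul_isUnit_right (hcug ▸ hcK)
  have hu'K : IsUnit (u' : K) := isUnit_of_mul_isUnit_left (hcug ▸ hcK)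
  -- `B ⊆ N[u'⁻¹]`
  have hBN : ∀ b ∈ B, ∃ k : ℕ, (u' : K) ^ k * b ∈ N := by
    intro b hb
    obtain ⟨n, m, hm, hmb⟩ := hB2 b hb
    -- `m ∈ 𝔪ⁿ ⊆ gⁿ R̄`
    have hmJ : algebraMap R N m ∈ J ^ n := by
      rw [hJ, ← Ideal.map_pow]; exact Ideal.mem_map_of_mem _ hm
    rw [hg, Ideal.span_singleton_pow] at hmJ
    obtain ⟨a, ha⟩ := Ideal.mem_span_singleton'.mp hmJ
    refine ⟨n, ?_⟩
    -- `cⁿ b = m = a gⁿ` and `c = u' g`, `g` a unit of `K`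
    have h1 : ((u' : K) * (g : K)) ^ n * b = (a : K) * (g : K) ^ n := by
      rw [← hcug, ← map_pow, hmb]
      have := congrArg (fun x : N => (x : K)) ha
      simpa using this.symm
    have h2 : (g : K) ^ n * ((u' : K) ^ n * b) = (g : K) ^ n * (a : K) := by
      rw [← mul_assoc, ← mul_pow, mul_comm (g : K), h1, mul_comm]
    rw [(hgK.pow n).mul_right_injective h2]
    exact a.2
  -- `u'` is a unit of `V`: `λ(g) = λ(c) v` with `v ∈ V`, by induction over `g ∈ 𝔪 R̄`
  have hP : ∀ x ∈ J, ∃ v ∈ V, lam (x : K) = lam (algebraMap R K c) * v := by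
    intro x hx
    rw [hJ, Ideal.map] at hx
    induction hx using Submodule.span_induction with
    | mem x hx =>
      obtain ⟨m, hm, rfl⟩ := hx
      obtain ⟨b, hb, hmb⟩ := hB1 m hm
      refine ⟨lam b, hBV ⟨b, hb⟩, ?_⟩
      change lam (algebraMap R K m) = _
      rw [hmb, map_mul]
    | zero => exact ⟨0, V.zero_mem, by simp⟩
    | add x y _ _ hx hy =>
      obtain ⟨v, hv, hxv⟩ := hx
      obtain ⟨w, hw, hyw⟩ := hy
      refine ⟨v + w, V.add_mem hv hw, ?_⟩
      rw [Subalgebra.coe_add, map_add, hxv, hyw, mul_add]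
    | smul a x _ hx =>
      obtain ⟨v, hv, hxv⟩ := hx
      refine ⟨lam (a : K) * v, V.mul_mem (hNV _ a.2) hv, ?_⟩
      rw [smul_eq_mul, Subalgebra.coe_mul, map_mul, hxv, mul_left_comm]
  obtain ⟨v, hvV, hgv⟩ := hP g hgJ
  have hu'v : lam (u' : K) * v = 1 := by
    have h1 : lam (algebraMap R K c) * (lam (u' : K) * v) = lam (algebraMap R K c) * 1 := by
      rw [mul_one, mul_left_comm, ← hgv, ← map_mul, ← hcug]
    exact hcQ.mul_right_injective h1
  -- absorbing units whose inverses lie in `V`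
  have absorb : ∀ e e' x : Q', e' * e = 1 → e' ∈ V → e * x ∈ V → x ∈ V := by
    intro e e' x hee' he' hex
    have : x = e' * (e * x) := by rw [← mul_assoc, hee', one_mul]
    rw [this]
    exact V.mul_mem he' hex
  have inv_of_primeCompl : ∀ s : B, s ∈ 𝔴.primeCompl → ∃ e' ∈ V, e' * lam (s : K) = 1 := by
    intro s hs
    obtain ⟨si, hsi⟩ := (IsLocalization.map_units R' (⟨s, hs⟩ : 𝔴.primeCompl)).exists_left_inv
    refine ⟨algebraMap R' Q' si, V.algebraMap_mem si, ?_⟩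
    rw [hlamB, ← map_mul, hsi, map_one]
  -- main argument
  intro z hz
  change IsIntegral R' z at hz
  -- (1) a multiple by `B ∖ 𝔴` is integral over `B`
  obtain ⟨⟨m, hm⟩, hmz⟩ :=
    IsIntegral.exists_multiple_integral_of_isLocalization 𝔴.primeCompl z hz
  have hmz' : IsIntegral B (lam (m : K) * z) := by
    have : (⟨m, hm⟩ : 𝔴.primeCompl) • z = lam (m : K) * z := by
      rw [Submonoid.smul_def, Algebra.smul_def]
      rfl
    rwa [this] at hmz
  -- (2) write it as a fraction `λ(y)/λ(s)` and descend to `K`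
  obtain ⟨⟨y, ⟨_, s, hs, rfl⟩⟩, hys⟩ :=
    IsLocalization.surj (𝔴.primeCompl.map (algebraMap B K)) (lam (m : K) * z)
  have hys' : lam (m : K) * z * lam (s : K) = lam y := hys
  have hyint : IsIntegral B (lam y) := by
    rw [← hys']
    exact hmz'.mul (isIntegral_algebraMap (R := B) (A := Q') (x := s))
  -- (3) descend along `K → Q' = K_𝔴`: a multiple `m' y`, `m' ∉ 𝔴`, is integral over `B` in `K`
  haveI : IsLocalization (Algebra.algebraMapSubmonoid K 𝔴.primeCompl) Q' :=
    ‹IsLocalization (𝔴.primeCompl.map (algebraMap B K)) Q'›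
  obtain ⟨m', hm', hint'⟩ :=
    IsLocalization.exists_isIntegral_smul_of_isIntegral_map (R := B) (S := K) (Sₘ := Q')
      𝔴.primeCompl (x := y) hyint
  have hint'' : IsIntegral B ((m' : K) * y) := by
    have : m' • y = (m' : K) * y := by rw [Subalgebra.smul_def, smul_eq_mul]
    rwa [this] at hint'
  -- (4) hence `u'ᵏ m' y ∈ R̄`
  obtain ⟨k, hk⟩ := exists_pow_mul_mem_of_isIntegral N B hNic u'.2 hBN hint''
  have hkV : lam ((u' : K) ^ k * (m' : K)) * lam y ∈ V := by
    rw [← map_mul, mul_assoc]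
    exact hNV _ hk
  -- (5) peel off the units
  obtain ⟨em, hemV, hem⟩ := inv_of_primeCompl m hm
  obtain ⟨es, hesV, hes⟩ := inv_of_primeCompl s hs
  obtain ⟨em', hem'V, hem'⟩ := inv_of_primeCompl m' hm'
  have hyV : lam y ∈ V := by
    refine absorb (lam ((u' : K) ^ k * (m' : K))) (v ^ k * em') (lam y) ?_
      (V.mul_mem (V.pow_mem hvV k) hem'V) hkV
    rw [map_mul, map_pow]
    calc v ^ k * em' * (lam (u' : K) ^ k * lam (m' : K))
        = (lam (u' : K) * v) ^ k * (em' * lam (m' : K)) := by ring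
      _ = 1 := by rw [hu'v, one_pow, hem', one_mul]
  have hmzV : lam (m : K) * z ∈ V := by
    refine absorb (lam (s : K)) es _ hes hesV ?_
    rw [mul_comm, hys']
    exact hyV
  exact absorb (lam (m : K)) em z hem hemV hmzV

end Key

end QuadraticTransform

end Literature.AlgebraicGeometry.Resolution

end
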